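import Literature.NumberTheory.EllipticCurves.SelmerInftyTorsionFiniteProofs
import Literature.Barriers.BirchSwinnertonDyer.DescentDefectUnboundedMatsunoCor33Proofs
import HarnessLib

/-!
# Kummer lift at level `p^J` over a subgroup: `H¹(H, E[p^J]) ↠ H¹(H, E[p^∞])[p^J]` (proofs only)

Topic `Literature/NumberTheory/EllipticCurves`, PROOFS file (theorems only, no definition, no named fact;
D-0026), sibling of `SelmerInftyTorsionFiniteProofs` ((A) `exists_torsionToPrimaryH1Sub_eq`: the case
`J = 1`) and of `Literature/Barriers/BirchSwinnertonDyer/DescentDefectUnboundedMatsunoCor33Proofs.lean`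
(`exists_torsionToPrimaryHom`: the case `H = Γ_K`, every `J`).

For a Weierstrass curve `W/K` (elliptic), a prime `p`, `J : ℕ` and ANY subgroup `H ≤ Γ_K` (e.g.
`H = Gal(K̄/K_∞) = ker κ` of a `ℤ_p`-extension): every class `x ∈ H¹(H, E[p^∞])` with `p^J · x = 0` is the
image of a class of `H¹(H, E[p^J])` under the map induced by `E[p^J] ↪ E[p^∞]`
(`WeierstrassCurve.exists_torsionPowToPrimaryH1Sub_eq`) — the piece
`H¹(H, E[p^J]) → H¹(H, E[p^∞])[p^J] → 0` of the cohomology sequence of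
`0 → E[p^J] → E[p^∞] →(p^J) E[p^∞] → 0`: if `p^J φ = ∂a`, write `a = p^J b` (`E[p^∞]` is divisible,
`exists_pow_nsmul_eq_geomPrimaryTorsion`); then `φ − ∂b` takes values in `E[p^J]`. Since every class of
`H¹(Gal(K̄/K_∞), E[p^∞])` is killed by some `p^J` (tree `exists_pow_smul_subgroupH1_ker_eq_zero`), every such
class comes from some finite level (`exists_torsionPow_lift_subgroupH1_ker`). Typed for the twisted
Poitou–Tate lifting (cell `bsd-2adic`, HOME/t42/DESIGN-T42-ADDENDUM-16.md, bricks (γ_∞)/(γ₂)/(β)).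

References: R. Greenberg, *Iwasawa theory for elliptic curves*, LNM 1716 (1999), §1 p. 60, §5 p. 114
[GreenbergLNM1716]; J. H. Silverman, *The Arithmetic of Elliptic Curves*, VIII §2, X §4 [SilvermanAEC2009].
-/

open CategoryTheory Literature.NumberTheory.EllipticCurves Literature.NumberTheory.GaloisRepresentations

universe u

noncomputable section

namespace WeierstrassCurve

open scoped Classical

variable {K : Type u} [Field K] (W : WeierstrassCurve K) (p : ℕ) [Fact p.Prime]
  (H : Subgroup (Field.absoluteGaloisGroup K)) (J : ℕ)

/-- **Kummer lift at level `p^J` over a subgroup: `H¹(H, E[p^J]) ↠ H¹(H, E[p^∞])[p^J]`.** If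
`p^J · x = 0` for `x ∈ H¹(H, E[p^∞])` then `x` is the image of a class of `H¹(H, E[p^J])` under
`(E[p^J] ↪ E[p^∞])_*` (`resH1Hom` along `(id_H, inclusion)`): `p^J φ = ∂a`, `a = p^J b`, and `φ − ∂b`
takes values in `E[p^J]`. The argument of the tree's `exists_torsionToPrimaryH1Sub_eq` (`J = 1`) and
`exists_torsionToPrimaryHom` (`H = Γ_K`). [cite: GreenbergLNM1716, §5 p. 114] -/
theorem exists_torsionPowToPrimaryH1Sub_eq (hdiv : W.zsmul_geomPoints_surjective) [W.IsElliptic]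
    {x : W.subgroupH1 p H} (hx : p ^ J • x = 0) :
    ∃ y : Literature.NumberTheory.EllipticCurves.subgroupH1 H (geomTorsion W ((p ^ J : ℕ) : ℤ)),
      resH1Hom (ContinuousMonoidHom.id H)
        (AddSubgroup.inclusion
          (Literature.Barriers.BirchSwinnertonDyer.geomTorsion_pow_le_geomPrimaryTorsion W p J))
        (fun _ _ ↦ rfl) y = x := by
  obtain ⟨φ, rfl⟩ := oneCocycleClass_surjective _ x
  have h := oneCocycleClass_smul (discreteTopRep H (geomPrimaryTorsion W p)) ((p ^ J : ℕ) : ℤ) φ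
  conv at h => rhs; rw [Nat.cast_smul_eq_nsmul, hx]
  obtain ⟨a, ha⟩ := (oneCocycleClass_eq_zero_iff _ _).mp h
  have ha' : ∀ σ : H, p ^ J • φ.1 σ = σ • a - a := fun σ ↦ by
    rw [← natCast_zsmul, Nat.cast_pow]
    have := ha σ
    rwa [Nat.cast_pow] at this
  obtain ⟨b, rfl⟩ :=
    Literature.Barriers.BirchSwinnertonDyer.exists_pow_nsmul_eq_geomPrimaryTorsion W p J hdiv a
  set φ' := φ - cobCocycle b (W.continuous_smul_geomPrimaryTorsion_sub p b) with hφ'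
  have hval : ∀ σ : H, p ^ J • φ'.1 σ = 0 := fun σ ↦ by
    change p ^ J • (φ.1 σ - (σ • b - b)) = 0
    rw [smul_sub, ha', smul_sub, smul_comm, sub_self]
  have hmem : ∀ σ : H,
      ((φ'.1 σ : geomPrimaryTorsion W p) : geomPoints W) ∈ geomTorsion W ((p ^ J : ℕ) : ℤ) := fun σ ↦
    AddSubgroup.torsionBy.nsmul_iff.mpr (by
      rw [← AddSubgroupClass.coe_nsmul, hval σ, ZeroMemClass.coe_zero])
  let χ : contOneCocycles (discreteTopRep H (geomTorsion W ((p ^ J : ℕ) : ℤ))) :=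
    contOneCocycles.lift
      (AddSubgroup.inclusion
        (Literature.Barriers.BirchSwinnertonDyer.geomTorsion_pow_le_geomPrimaryTorsion W p J))
      (fun _ _ ↦ rfl) (AddSubgroup.inclusion_injective _) φ' (fun σ ↦ ⟨_, hmem σ⟩)
      (fun _ ↦ rfl)
  refine ⟨oneCocycleClass _ χ, ?_⟩
  rw [resH1Hom_id_oneCocycleClass, contOneCocycles.push_lift, hφ', oneCocycleClass_sub,
    oneCocycleClass_cobCocycle, sub_zero]

variable {p H J} in
omit [Fact p.Prime] in
/-- The lifted cocycle can be chosen to AGREE with a given cocycle of the class after the latter is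
normalised: explicit form — for every `y`, the image class is that of the pushed cocycle
(`resH1Hom_id_oneCocycleClass`, restated for the inclusion `E[p^J] ↪ E[p^∞]`).
[cite: GreenbergLNM1716, §5 p. 114] -/
theorem resH1Hom_inclusion_oneCocycleClass
    (ψ : contOneCocycles (discreteTopRep H (geomTorsion W ((p ^ J : ℕ) : ℤ)))) :
    resH1Hom (ContinuousMonoidHom.id H)
        (AddSubgroup.inclusion
          (Literature.Barriers.BirchSwinnertonDyer.geomTorsion_pow_le_geomPrimaryTorsion W p J))
        (fun _ _ ↦ rfl) (oneCocycleClass _ ψ) =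
      oneCocycleClass _ (contOneCocycles.push
        (AddSubgroup.inclusion
          (Literature.Barriers.BirchSwinnertonDyer.geomTorsion_pow_le_geomPrimaryTorsion W p J))
        (fun _ _ ↦ rfl) ψ) :=
  resH1Hom_id_oneCocycleClass _ _ ψ

variable [NumberField K] (κ : ZpExtension K p)

/-- **Every class of `H¹(K_∞, E[p^∞])` comes from `H¹(K_∞, E[p^J])` for some `J`** (it is killed by some
`p^J`, tree `exists_pow_smul_subgroupH1_ker_eq_zero`; then `exists_torsionPowToPrimaryH1Sub_eq`).
[cite: GreenbergLNM1716, §1 p. 60, §5 p. 114] -/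
theorem exists_torsionPow_lift_subgroupH1_ker (hdiv : W.zsmul_geomPoints_surjective) [W.IsElliptic]
    (x : W.subgroupH1 p κ.kerSubgroup) :
    ∃ (J : ℕ) (y : Literature.NumberTheory.EllipticCurves.subgroupH1 κ.kerSubgroup
        (geomTorsion W ((p ^ J : ℕ) : ℤ))),
      resH1Hom (ContinuousMonoidHom.id κ.kerSubgroup)
        (AddSubgroup.inclusion
          (Literature.Barriers.BirchSwinnertonDyer.geomTorsion_pow_le_geomPrimaryTorsion W p J))
        (fun _ _ ↦ rfl) y = x := by
  obtain ⟨J, hJ⟩ := W.exists_pow_smul_subgroupH1_ker_eq_zero κ x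
  exact ⟨J, W.exists_torsionPowToPrimaryH1Sub_eq p κ.kerSubgroup J hdiv hJ⟩

omit [NumberField K] [Fact p.Prime] in
/-- **The kernel of `H¹(H, E[p^J]) → H¹(H, E[p^∞])` is killed by the exponent of `E[p^∞]^H`** (the piece
`E[p^∞]^H →(p^J) E[p^∞]^H → H¹(H, E[p^J]) → H¹(H, E[p^∞])` of the cohomology sequence of
`0 → E[p^J] → E[p^∞] →(p^J) E[p^∞] → 0`: the kernel is a quotient of `E[p^∞]^H`). If `n · P = 0` for every
`H`-fixed `P ∈ E[p^∞]` then every `y ∈ H¹(H, E[p^J])` with image `0` in `H¹(H, E[p^∞])` has `n · y = 0`: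
`ι ∘ z = ∂Q` with `Q ∈ E[p^∞]`, `p^J Q` is `H`-fixed, so `n p^J Q = 0`, i.e. `nQ ∈ E[p^J]`, and
`n z = ∂(nQ)` inside `E[p^J]`. (For `H = Gal(K̄/K_∞)` and `E(K_∞)[p^∞]` finite of exponent `n` this
bounds the kernels uniformly in `J`; twisted Poitou–Tate lifting, cell `bsd-2adic` ADDENDUM-16 (β).)
[cite: GreenbergLNM1716, §3 p. 73 (kernel of `H¹(E[p^n]) → H¹(E[p^∞])` = image of `H⁰(E[p^∞])`)] -/
theorem nsmul_eq_zero_of_resH1Hom_inclusion_eq_zero {n : ℕ}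
    (hB : ∀ P : geomPrimaryTorsion W p, (∀ h : H, h • P = P) → n • P = 0)
    {y : Literature.NumberTheory.EllipticCurves.subgroupH1 H (geomTorsion W ((p ^ J : ℕ) : ℤ))}
    (hy : resH1Hom (ContinuousMonoidHom.id H)
        (AddSubgroup.inclusion
          (Literature.Barriers.BirchSwinnertonDyer.geomTorsion_pow_le_geomPrimaryTorsion W p J))
        (fun _ _ ↦ rfl) y = 0) :
    n • y = 0 := by
  have hle := Literature.Barriers.BirchSwinnertonDyer.geomTorsion_pow_le_geomPrimaryTorsion W p J
  obtain ⟨z, rfl⟩ := oneCocycleClass_surjective _ y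
  rw [resH1Hom_inclusion_oneCocycleClass] at hy
  obtain ⟨Q, hQ⟩ := (oneCocycleClass_eq_zero_iff _ _).mp hy
  have hQh : ∀ h : H, AddSubgroup.inclusion hle (z.1 h) = h • Q - Q := fun h ↦ hQ h
  -- `p^J • Q` is `H`-fixed, hence killed by `n`
  have hfix : ∀ h : H, h • (p ^ J • Q) = p ^ J • Q := fun h ↦ by
    rw [smul_comm, ← sub_eq_zero, ← smul_sub, ← hQh h, ← map_nsmul, AddSubgroup.torsionBy.nsmul,
      map_zero]
  have hnQ : p ^ J • (n • Q) = 0 := by rw [smul_comm, hB _ hfix]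
  have hmem : (((n • Q : geomPrimaryTorsion W p)) : geomPoints W) ∈ geomTorsion W ((p ^ J : ℕ) : ℤ) :=
    AddSubgroup.torsionBy.nsmul_iff.mpr (by rw [← AddSubmonoidClass.coe_nsmul, hnQ, ZeroMemClass.coe_zero])
  set R : geomTorsion W ((p ^ J : ℕ) : ℤ) := ⟨_, hmem⟩ with hRdef
  have hR : AddSubgroup.inclusion hle R = n • Q := rfl
  -- `n • [z] = [(n : ℤ) • z] = [∂R] = 0`
  have hs := oneCocycleClass_smul (discreteTopRep H (geomTorsion W ((p ^ J : ℕ) : ℤ))) ((n : ℕ) : ℤ) z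
  conv at hs => rhs; rw [Nat.cast_smul_eq_nsmul]
  rw [← hs]
  refine (oneCocycleClass_eq_zero_iff _ _).mpr ⟨R, fun h ↦ AddSubgroup.inclusion_injective hle ?_⟩
  change AddSubgroup.inclusion hle ((n : ℤ) • z.1 h) = AddSubgroup.inclusion hle (h • R - R)
  rw [map_zsmul, hQh h, map_sub]
  change (n : ℤ) • (h • Q - Q) = h • AddSubgroup.inclusion hle R - AddSubgroup.inclusion hle R
  rw [hR, natCast_zsmul, smul_sub, smul_comm]

end WeierstrassCurve

end
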